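import Literature.NumberTheory.GaloisRepresentations.PotentialDiagonalizabilityCriteriaProofs
import Literature.NumberTheory.GaloisRepresentations.PstWeilDeligne
import HarnessLib

/-!
# The diagonal blocks of a de Rham framed Galois representation are de Rham
(support item stmt-Langlands-14329 `IrreducibilityBySelfDuality.IrreducibleOffSector`, route
`route-Langlands-IrreducibilityBySelfDuality`, line `Sketch`, stub `stub_deRhamBlocks`; `--supports`
file, does NOT import the Theses file)

For a non-archimedean local field `F`, a `p`-adic Hodge datum `𝔇 : PstWeilDeligneData F ℓ` (an
arbitrary regular `(ℚ_ℓ, Γ_F)`-ring `𝔇.𝔅` with `B^{Γ_F} = F`, intended `B_dR(F)`) and a framed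
`ρ : Γ_F →ₜ* GL_n(ℚ̄_ℓ)` which in some frame is block upper triangular, `P ρ P⁻¹ = (A B; 0 D)` along
`Fin m ⊕ Fin p ≃ Fin n`: if `ρ` is de Rham for `𝔇` (`PstWeilDeligneData.IsDeRhamFramed`: a model
over a finite `E/ℚ_ℓ` has `𝔅`-admissible underlying `ℚ_ℓ`-linear representation) then so are `A`
and `D` (`stub_deRhamBlocks`).  This is Fontaine's "sub-objects and quotients of `B`-admissible
representations are `B`-admissible" (Astérisque 223, Exposé III, Prop. 1.5.2) for framed
representations with models over finite extensions of `ℚ_ℓ`: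
`isAdmissible_restrictScalars_baseChange_of_le` (ASCENT of admissibility along a finite extension
`E' ≤ E''` of the coefficients, `(r ⊗_{E'} E'')|_{ℚ_ℓ} ≅ (r|_{ℚ_ℓ})^{[E'':E']}` and
`PeriodRingData.isAdmissible_pi_iff`; the descent is the tree's `isAdmissible_restrictScalars_of_le`),
`isAdmissible_restrictScalars_conj_iff` (invariance under `GL_n(E)`-conjugation),
`isAdmissible_blocks_of_eq_reindex_fromBlocks` (`0 → Eᵐ → Eⁿ → Eᵖ → 0` is an exact sequence of
`ℚ_ℓ`-linear representations; `PeriodRingData.isAdmissible_of_shortExact`, resting on Fontaine's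
inequality `finrank_D_le_holds` and the exactness of `B ⊗_{ℚ_ℓ} −`), and the bookkeeping of models
(`exists_finiteDimensional_mem_entries`, `FramedRep.exists_baseChange_eq`).

References: J.-M. Fontaine, *Représentations `p`-adiques semi-stables*, Astérisque 223 (1994),
Exposé III, §1.5, Prop. 1.5.2; K. Buzzard, T. Gee, *The conjectural connections between automorphic
representations and Galois representations* (2014), §2.2 (independence of the coefficient field).
-/
noncomputable section

-- `Summit.Langlands.Langlands.…` (summit = sub-problem name, D-0017 layout) trips `dupNamespace` on
-- every declaration; the project-wide lakefile option is repeated here for stand-alone elaboration.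
set_option linter.dupNamespace false

open scoped Matrix
open Field
open Literature.NumberTheory.GaloisRepresentations Literature.NumberTheory.Automorphic

namespace Summit.Langlands.Langlands.Theorems.IrreducibleOffSector

/-! ## Admissibility of `ℚ_p`-restrictions of framed representations over finite `E/ℚ_p` -/

section Models

universe u v w

variable {p : ℕ} [Fact p.Prime] {Γ : Type u} [Group Γ] [TopologicalSpace Γ]
  {L : Type v} [Field L] [Algebra ℚ_[p] L] {n : ℕ}
  (𝔅 : PeriodRingData.{u, 0, v, w} Γ ℚ_[p] L)

-- Mathlib's own global value (nested instance problems on `𝔅.B ⊗[P] M`).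
set_option maxSynthPendingDepth 3 in
/-- **Ascent of admissibility along a finite extension of the coefficients.**  If `r` is a
continuous framed representation over `E'` whose underlying `ℚ_p`-linear representation is
`B`-admissible, then so is the underlying `ℚ_p`-linear representation of its extension of scalars to
`E'' ⊇ E'` (finite over `ℚ_p`): as `ℚ_p[Γ]`-modules `E''ⁿ ≅ (E'ⁿ)^d`, `d = [E'' : E']`, and finite
direct sums of admissible representations are admissible.
Ref: Fontaine, Astérisque 223 (1994), Exposé III, Prop. 1.5.2; Buzzard–Gee 2014, §2.2. [folklore] -/
theorem isAdmissible_restrictScalars_baseChange_of_le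
    {E' E'' : IntermediateField ℚ_[p] (PadicAlgCl p)} (h : E' ≤ E'') [FiniteDimensional ℚ_[p] E'']
    (r : FramedRep Γ E' n) (hadm : 𝔅.IsAdmissible (FramedRep.restrictScalars ℚ_[p] r)) :
    𝔅.IsAdmissible (FramedRep.restrictScalars ℚ_[p]
      (r.baseChange (IntermediateField.inclusion h).toRingHom
        (continuous_intermediateField_inclusion h))) := by
  classical
  letI : Algebra E' E'' := (IntermediateField.inclusion h).toRingHom.toAlgebra
  haveI : IsScalarTower ℚ_[p] E' E'' :=
    IsScalarTower.of_algebraMap_eq fun x => ((IntermediateField.inclusion h).commutes x).symm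
  haveI : FiniteDimensional E' E'' := Module.Finite.of_restrictScalars_finite ℚ_[p] E' E''
  haveI : FiniteDimensional ℚ_[p] E' := Module.Finite.of_injective
    (IntermediateField.inclusion h).toLinearMap (IntermediateField.inclusion h).toRingHom.injective
  set d := Module.finrank E' E''
  let b : Module.Basis (Fin d) E' E'' := Module.finBasis E' E''
  -- the `ℚ_p`-linear isomorphism `(E'ⁿ)^d ≃ E''ⁿ`, `w ↦ (i ↦ Σ_k w k i • b k)`
  let e₀ : (Fin d → E') ≃ₗ[ℚ_[p]] E'' := b.equivFun.symm.restrictScalars ℚ_[p]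
  let sw : (Fin d → Fin n → E') ≃ₗ[ℚ_[p]] (Fin n → Fin d → E') :=
    { toFun := fun w i k => w k i, invFun := fun v k i => v i k, map_add' := fun _ _ => rfl,
      map_smul' := fun _ _ => rfl, left_inv := fun _ => rfl, right_inv := fun _ => rfl }
  let Φ : (Fin d → Fin n → E') ≃ₗ[ℚ_[p]] (Fin n → E'') :=
    sw.trans (LinearEquiv.piCongrRight fun _ => e₀)
  have hΦ : ∀ (w : Fin d → Fin n → E') (i : Fin n), Φ w i = ∑ k, w k i • b k := fun w i => by
    change b.equivFun.symm (fun k => w k i) = _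
    rw [Module.Basis.equivFun_symm_apply]
  -- the representation `(r|_{ℚ_p})^d` on `(E'ⁿ)^d`
  obtain ⟨ρπ, hρπ⟩ := ContinuousRep.exists_pi (fun _ : Fin d => FramedRep.restrictScalars ℚ_[p] r)
  have hequiv : ∀ (σ : Γ) (w : Fin d → Fin n → E'),
      Φ (ρπ σ w) = (FramedRep.restrictScalars ℚ_[p] (r.baseChange
        (IntermediateField.inclusion h).toRingHom (continuous_intermediateField_inclusion h))) σ
          (Φ w) := by
    intro σ w
    funext i
    rw [FramedRep.restrictScalars_apply_apply, FramedRep.coe_baseChange_apply, hΦ]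
    simp only [hρπ, FramedRep.restrictScalars_apply_apply, Matrix.mulVec, dotProduct,
      Matrix.map_apply, hΦ, Finset.mul_sum, Finset.sum_smul]
    rw [Finset.sum_comm]
    refine Finset.sum_congr rfl fun j _ => Finset.sum_congr rfl fun k _ => ?_
    rw [Algebra.smul_def, Algebra.smul_def, map_mul, mul_assoc]
    rfl
  have h1 : 𝔅.IsAdmissible ρπ :=
    (𝔅.isAdmissible_pi_iff ρπ (fun _ : Fin d => FramedRep.restrictScalars ℚ_[p] r) hρπ).2
      fun _ => hadm
  exact (𝔅.isAdmissible_iff_of_equiv ρπ _ Φ hequiv).1 h1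

set_option maxSynthPendingDepth 3 in
/-- **Admissibility of the underlying `ℚ_p`-linear representation is invariant under change of
frame**: `v ↦ P v` is an equivariant `ℚ_p`-linear isomorphism from `r|_{ℚ_p}` to `(P r P⁻¹)|_{ℚ_p}`.
Ref: Fontaine, Astérisque 223 (1994), Exposé III §1.5 (admissibility is a property of the
isomorphism class). [folklore] -/
theorem isAdmissible_restrictScalars_conj_iff {E : IntermediateField ℚ_[p] (PadicAlgCl p)}
    (P : GL (Fin n) E) (r : FramedRep Γ E n) :
    𝔅.IsAdmissible (FramedRep.restrictScalars ℚ_[p] (FramedRep.conj P r)) ↔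
      𝔅.IsAdmissible (FramedRep.restrictScalars ℚ_[p] r) := by
  let eP : (Fin n → E) ≃ₗ[ℚ_[p]] (Fin n → E) :=
    { toFun := fun v => (P : Matrix (Fin n) (Fin n) E) *ᵥ v
      invFun := fun v => ((P⁻¹ : GL (Fin n) E) : Matrix (Fin n) (Fin n) E) *ᵥ v
      map_add' := fun v w => Matrix.mulVec_add _ v w
      map_smul' := fun c v => by
        simp only [RingHom.id_apply]
        rw [← algebraMap_smul E c v, Matrix.mulVec_smul, algebraMap_smul]
      left_inv := fun v => show ((P⁻¹ : GL (Fin n) E) : Matrix (Fin n) (Fin n) E) *ᵥ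
          ((P : Matrix (Fin n) (Fin n) E) *ᵥ v) = v by
        rw [Matrix.mulVec_mulVec, ← Units.val_mul, inv_mul_cancel, Units.val_one, Matrix.one_mulVec]
      right_inv := fun v => show (P : Matrix (Fin n) (Fin n) E) *ᵥ
          (((P⁻¹ : GL (Fin n) E) : Matrix (Fin n) (Fin n) E) *ᵥ v) = v by
        rw [Matrix.mulVec_mulVec, ← Units.val_mul, mul_inv_cancel, Units.val_one, Matrix.one_mulVec] }
  have heP : ∀ (σ : Γ) (v : Fin n → E),
      eP (FramedRep.restrictScalars ℚ_[p] r σ v) =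
        FramedRep.restrictScalars ℚ_[p] (FramedRep.conj P r) σ (eP v) := by
    intro σ v
    have hu : FramedRep.conj P r σ * P = P * r σ := by
      rw [FramedRep.conj_apply, inv_mul_cancel_right]
    change (P : Matrix (Fin n) (Fin n) E) *ᵥ
        (((r σ : GL (Fin n) E) : Matrix (Fin n) (Fin n) E) *ᵥ v) =
      ((FramedRep.conj P r σ : GL (Fin n) E) : Matrix (Fin n) (Fin n) E) *ᵥ
        ((P : Matrix (Fin n) (Fin n) E) *ᵥ v)
    rw [Matrix.mulVec_mulVec, Matrix.mulVec_mulVec, ← Units.val_mul, ← Units.val_mul, hu]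
  exact (𝔅.isAdmissible_iff_of_equiv _ _ eP heP).symm

set_option maxSynthPendingDepth 3 in
/-- **The diagonal blocks of an admissible block upper triangular representation are admissible**
(model level).  If `M : Γ →ₜ* GL_n(E)` has the block form `M = (a b; 0 d)` along
`e : Fin m ⊕ Fin q ≃ Fin n` and `M|_{ℚ_p}` is `B`-admissible, then so are `a|_{ℚ_p}` and `d|_{ℚ_p}`:
`x ↦ (x, 0) ∘ e⁻¹` and `y ↦ (y ∘ e)|_{inr}` form an exact sequence `0 → Eᵐ → Eⁿ → E^q → 0` of
`ℚ_p`-linear representations, and sub-objects and quotients of admissible representations are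
admissible.  Ref: Fontaine, Astérisque 223 (1994), Exposé III, Prop. 1.5.2. [folklore] -/
theorem isAdmissible_blocks_of_eq_reindex_fromBlocks {E : IntermediateField ℚ_[p] (PadicAlgCl p)}
    [FiniteDimensional ℚ_[p] E] {m q : ℕ} (e : Fin m ⊕ Fin q ≃ Fin n) (M : FramedRep Γ E n)
    (a : FramedRep Γ E m) (d : FramedRep Γ E q) (b : Γ → Matrix (Fin m) (Fin q) E)
    (hM : ∀ σ, ((M σ : GL (Fin n) E) : Matrix (Fin n) (Fin n) E) =
      Matrix.reindex e e (Matrix.fromBlocks ((a σ : GL (Fin m) E) : Matrix (Fin m) (Fin m) E)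
        (b σ) 0 ((d σ : GL (Fin q) E) : Matrix (Fin q) (Fin q) E)))
    (hadm : 𝔅.IsAdmissible (FramedRep.restrictScalars ℚ_[p] M)) :
    𝔅.IsAdmissible (FramedRep.restrictScalars ℚ_[p] a) ∧
      𝔅.IsAdmissible (FramedRep.restrictScalars ℚ_[p] d) := by
  -- the action of `M σ` on a reindexed vector
  have hMv : ∀ (σ : Γ) (v : Fin m ⊕ Fin q → E),
      ((M σ : GL (Fin n) E) : Matrix (Fin n) (Fin n) E) *ᵥ (v ∘ e.symm) =
        (Sum.elim (((a σ : GL (Fin m) E) : Matrix (Fin m) (Fin m) E) *ᵥ (v ∘ Sum.inl) +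
            b σ *ᵥ (v ∘ Sum.inr))
          (((d σ : GL (Fin q) E) : Matrix (Fin q) (Fin q) E) *ᵥ (v ∘ Sum.inr))) ∘ e.symm := by
    intro σ v
    rw [hM σ, Matrix.reindex_apply, Matrix.submatrix_mulVec_equiv, Matrix.fromBlocks_mulVec,
      Matrix.zero_mulVec, zero_add]
    have hv : (v ∘ ⇑e.symm) ∘ ⇑e.symm.symm = v := by
      funext s; simp
    rw [hv]
  -- the inclusion of the first block and the projection onto the second
  let ι : (Fin m → E) →ₗ[ℚ_[p]] (Fin n → E) :=
    { toFun := fun x => Sum.elim x 0 ∘ e.symm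
      map_add' := fun x y => by
        funext k
        simp only [Function.comp_apply, Pi.add_apply]
        generalize e.symm k = s
        rcases s with i | j <;> simp
      map_smul' := fun c x => by
        funext k
        simp only [Function.comp_apply, RingHom.id_apply, Pi.smul_apply]
        generalize e.symm k = s
        rcases s with i | j <;> simp }
  have hι : ∀ x, ι x = Sum.elim x 0 ∘ e.symm := fun _ => rfl
  let π : (Fin n → E) →ₗ[ℚ_[p]] (Fin q → E) :=
    { toFun := fun y j => y (e (Sum.inr j)), map_add' := fun _ _ => rfl, map_smul' := fun _ _ => rfl }
  have hπ : ∀ y, π y = fun j => y (e (Sum.inr j)) := fun _ => rfl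
  refine 𝔅.isAdmissible_of_shortExact (FramedRep.restrictScalars ℚ_[p] a)
    (FramedRep.restrictScalars ℚ_[p] M) (FramedRep.restrictScalars ℚ_[p] d) ι π
    ?_ ?_ ?_ ?_ ?_ hadm
  · -- `ι` is equivariant
    intro σ x
    rw [FramedRep.restrictScalars_apply_apply, FramedRep.restrictScalars_apply_apply, hι, hι, hMv]
    congr 1
    simp
  · -- `π` is equivariant
    intro σ y
    rw [FramedRep.restrictScalars_apply_apply, FramedRep.restrictScalars_apply_apply, hπ, hπ]
    have hy : y = (y ∘ e) ∘ e.symm := by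
      funext k; simp
    have hy' : (fun j => y (e (Sum.inr j))) = (y ∘ e) ∘ Sum.inr := rfl
    rw [hy']
    conv_lhs => rw [hy, hMv]
    funext j
    simp
  · -- `ι` is injective
    intro x x' hx
    funext i
    have := congr_fun hx (e (Sum.inl i))
    simpa [hι] using this
  · -- `π` is surjective
    intro z
    refine ⟨Sum.elim 0 z ∘ e.symm, ?_⟩
    funext j
    simp [hπ]
  · -- exactness
    intro y
    constructor
    · intro hy
      refine ⟨fun i => y (e (Sum.inl i)), ?_⟩
      funext k
      obtain ⟨s, rfl⟩ := e.surjective k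
      rcases s with i | j
      · simp [hι]
      · have := congr_fun hy j
        simp only [hπ, Pi.zero_apply] at this
        simp [hι, this]
    · rintro ⟨x, rfl⟩
      funext j
      simp [hι, hπ]

end Models

/-! ## Models of the blocks and the proof of the stub -/

section Blocks

/-- `conj 1 ρ = ρ`. [folklore] -/
theorem conj_one_eq {G : Type*} [Group G] [TopologicalSpace G] {A : Type*} [CommRing A]
    [TopologicalSpace A] [IsTopologicalRing A] {n : ℕ} (ρ : FramedRep G A n) :
    FramedRep.conj 1 ρ = ρ :=
  ContinuousMonoidHom.ext fun g => by simp

set_option maxSynthPendingDepth 3 in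
/-- **The diagonal blocks of a de Rham framed representation are de Rham.**  Let
`𝔇 : PstWeilDeligneData F ℓ`, `ρ : Γ_F →ₜ* GL_n(ℚ̄_ℓ)` and suppose `P ρ P⁻¹ = (A B; 0 D)` along
`e : Fin m ⊕ Fin p ≃ Fin n` with framed `A`, `D`.  If `ρ` is de Rham for `𝔇` then so are `A` and `D`.
Proof: a model `rE` of `ρ` over a finite `E/ℚ_ℓ` with `Q (rE ⊗ ℚ̄_ℓ) Q⁻¹ = ρ` and `rE|_{ℚ_ℓ}`
admissible is enlarged to `E₂ = E(entries of PQ, (PQ)⁻¹)` (admissible by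
`isAdmissible_restrictScalars_baseChange_of_le`) and conjugated by `PQ ∈ GL_n(E₂)` to a model `M`
of the block form (admissible by `isAdmissible_restrictScalars_conj_iff`); the blocks of `M` are
models of `A` and `D` over `E₂`, admissible by `isAdmissible_blocks_of_eq_reindex_fromBlocks`
(Fontaine, Exposé III, Prop. 1.5.2: sub-objects and quotients of `B`-admissible representations are
`B`-admissible). [cite: FontaineAsterisque223III, Exposé III Prop. 1.5.2] -/
theorem stub_deRhamBlocks :
    ∀ {F : Type} [Field F] [ValuativeRel F] [TopologicalSpace F] [IsNonarchimedeanLocalField F]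
      {ℓ : ℕ} [Fact ℓ.Prime] (𝔇 : PstWeilDeligneData F ℓ) {n m p : ℕ} (e : Fin m ⊕ Fin p ≃ Fin n)
      (P : GL (Fin n) (PadicAlgCl ℓ)) (ρ : FramedRep (Field.absoluteGaloisGroup F) (PadicAlgCl ℓ) n)
      (A : FramedRep (Field.absoluteGaloisGroup F) (PadicAlgCl ℓ) m)
      (D : FramedRep (Field.absoluteGaloisGroup F) (PadicAlgCl ℓ) p)
      (B : Field.absoluteGaloisGroup F → Matrix (Fin m) (Fin p) (PadicAlgCl ℓ)),
      (∀ g, ((FramedRep.conj P ρ g : GL (Fin n) (PadicAlgCl ℓ)) : Matrix (Fin n) (Fin n) (PadicAlgCl ℓ)) =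
        Matrix.reindex e e (Matrix.fromBlocks
          ((A g : GL (Fin m) (PadicAlgCl ℓ)) : Matrix (Fin m) (Fin m) (PadicAlgCl ℓ)) (B g) 0
          ((D g : GL (Fin p) (PadicAlgCl ℓ)) : Matrix (Fin p) (Fin p) (PadicAlgCl ℓ)))) →
      𝔇.IsDeRhamFramed ρ → 𝔇.IsDeRhamFramed A ∧ 𝔇.IsDeRhamFramed D := by
  intro F _ _ _ _ ℓ _ 𝔇 n m p e P ρ A D B hblock hρ
  letI : Algebra ℚ_[ℓ] F := 𝔇.algebra
  obtain ⟨E, hE, rE, ⟨Q, hQ⟩, hadm⟩ := hρ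
  haveI := hE
  -- Step 1: enlarge `E` by the entries of `PQ` and `(PQ)⁻¹`
  obtain ⟨E_PQ, hE_PQ, hPQmem⟩ := exists_finiteDimensional_mem_entries (P * Q)
  haveI := hE_PQ
  have h1 : E ≤ E ⊔ E_PQ := le_sup_left
  have h2 : E_PQ ≤ E ⊔ E_PQ := le_sup_right
  -- from here on `E₂ = E ⊔ E_PQ`
  generalize hE₂ : E ⊔ E_PQ = E₂ at h1 h2
  haveI : FiniteDimensional ℚ_[ℓ] E₂ := by rw [← hE₂]; infer_instance
  -- Step 2: the base change of the model to `E₂` is admissible (ascent)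
  let rE₂ : FramedRep (absoluteGaloisGroup F) E₂ n :=
    rE.baseChange (IntermediateField.inclusion h1).toRingHom
      (continuous_intermediateField_inclusion h1)
  have hadm₂ : 𝔇.𝔅.IsAdmissible (FramedRep.restrictScalars ℚ_[ℓ] rE₂) :=
    isAdmissible_restrictScalars_baseChange_of_le 𝔇.𝔅 h1 rE hadm
  have hrE₂ : rE₂.baseChange (algebraMap E₂ (PadicAlgCl ℓ)) continuous_subtype_val =
      rE.baseChange (algebraMap E (PadicAlgCl ℓ)) continuous_subtype_val := by
    refine ContinuousMonoidHom.ext fun g => Units.ext ?_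
    rw [FramedRep.coe_baseChange_apply, FramedRep.coe_baseChange_apply,
      FramedRep.coe_baseChange_apply, Matrix.map_map]
    rfl
  -- Step 3: `PQ` as an element of `GL_n(E₂)` and the model `M` of the block form
  have hPE : ∀ i j, ((P * Q : GL (Fin n) (PadicAlgCl ℓ)) : Matrix (Fin n) (Fin n) (PadicAlgCl ℓ))
      i j ∈ E₂ := fun i j => h2 (hPQmem i j).1
  have hPE' : ∀ i j, (((P * Q)⁻¹ : GL (Fin n) (PadicAlgCl ℓ)) :
      Matrix (Fin n) (Fin n) (PadicAlgCl ℓ)) i j ∈ E₂ := fun i j => h2 (hPQmem i j).2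
  obtain ⟨hm1, hm2⟩ := of_entries_mul_of_entries_inv E₂ (P * Q) hPE hPE'
  let PE : GL (Fin n) E₂ :=
    ⟨Matrix.of fun i j => ⟨((P * Q : GL (Fin n) (PadicAlgCl ℓ)) :
        Matrix (Fin n) (Fin n) (PadicAlgCl ℓ)) i j, hPE i j⟩,
      Matrix.of fun i j => ⟨(((P * Q)⁻¹ : GL (Fin n) (PadicAlgCl ℓ)) :
        Matrix (Fin n) (Fin n) (PadicAlgCl ℓ)) i j, hPE' i j⟩, hm1, hm2⟩
  have hPE_map : Matrix.GeneralLinearGroup.map (algebraMap E₂ (PadicAlgCl ℓ)) PE = P * Q := by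
    ext i j; rfl
  let M : FramedRep (absoluteGaloisGroup F) E₂ n := FramedRep.conj PE rE₂
  have hMmap : M.baseChange (algebraMap E₂ (PadicAlgCl ℓ)) continuous_subtype_val =
      FramedRep.conj P ρ := by
    change FramedRep.baseChange _ _ (FramedRep.conj PE rE₂) = _
    rw [FramedRep.baseChange_conj, hPE_map, hrE₂, ← hQ]
    refine ContinuousMonoidHom.ext fun g => ?_
    simp only [FramedRep.conj_apply, mul_inv_rev, mul_assoc]
  have hM : ∀ σ, ((M σ : GL (Fin n) E₂) : Matrix (Fin n) (Fin n) E₂).map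
      (algebraMap E₂ (PadicAlgCl ℓ)) =
        Matrix.reindex e e (Matrix.fromBlocks
          ((A σ : GL (Fin m) (PadicAlgCl ℓ)) : Matrix (Fin m) (Fin m) (PadicAlgCl ℓ)) (B σ) 0
          ((D σ : GL (Fin p) (PadicAlgCl ℓ)) : Matrix (Fin p) (Fin p) (PadicAlgCl ℓ))) := by
    intro σ
    rw [← hblock σ, ← hMmap, FramedRep.coe_baseChange_apply]
  have hadmM : 𝔇.𝔅.IsAdmissible (FramedRep.restrictScalars ℚ_[ℓ] M) :=
    (isAdmissible_restrictScalars_conj_iff 𝔇.𝔅 PE rE₂).2 hadm₂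
  -- Step 4: the entries of the blocks lie in `E₂`; models `mA`, `mD` of `A`, `D` over `E₂`
  have hMe : ∀ σ (s t : Fin m ⊕ Fin p),
      algebraMap E₂ (PadicAlgCl ℓ) (((M σ : GL (Fin n) E₂) : Matrix (Fin n) (Fin n) E₂) (e s) (e t)) =
        Matrix.fromBlocks
          ((A σ : GL (Fin m) (PadicAlgCl ℓ)) : Matrix (Fin m) (Fin m) (PadicAlgCl ℓ)) (B σ) 0
          ((D σ : GL (Fin p) (PadicAlgCl ℓ)) : Matrix (Fin p) (Fin p) (PadicAlgCl ℓ)) s t := by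
    intro σ s t
    rw [← Matrix.map_apply (f := algebraMap E₂ (PadicAlgCl ℓ)), hM σ, Matrix.reindex_apply,
      Matrix.submatrix_apply, Equiv.symm_apply_apply, Equiv.symm_apply_apply]
  have hAmem : ∀ σ i j,
      ((A σ : GL (Fin m) (PadicAlgCl ℓ)) : Matrix (Fin m) (Fin m) (PadicAlgCl ℓ)) i j ∈ E₂ := by
    intro σ i j
    rw [← Matrix.fromBlocks_apply₁₁
      ((A σ : GL (Fin m) (PadicAlgCl ℓ)) : Matrix (Fin m) (Fin m) (PadicAlgCl ℓ)) (B σ) 0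
      ((D σ : GL (Fin p) (PadicAlgCl ℓ)) : Matrix (Fin p) (Fin p) (PadicAlgCl ℓ)), ← hMe]
    exact SetLike.coe_mem _
  have hDmem : ∀ σ i j,
      ((D σ : GL (Fin p) (PadicAlgCl ℓ)) : Matrix (Fin p) (Fin p) (PadicAlgCl ℓ)) i j ∈ E₂ := by
    intro σ i j
    rw [← Matrix.fromBlocks_apply₂₂
      ((A σ : GL (Fin m) (PadicAlgCl ℓ)) : Matrix (Fin m) (Fin m) (PadicAlgCl ℓ)) (B σ) 0
      ((D σ : GL (Fin p) (PadicAlgCl ℓ)) : Matrix (Fin p) (Fin p) (PadicAlgCl ℓ)), ← hMe]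
    exact SetLike.coe_mem _
  obtain ⟨mA, hmA⟩ := FramedRep.exists_baseChange_eq A E₂ fun σ i j =>
    ⟨hAmem σ i j, by rw [← map_inv]; exact hAmem σ⁻¹ i j⟩
  obtain ⟨mD, hmD⟩ := FramedRep.exists_baseChange_eq D E₂ fun σ i j =>
    ⟨hDmem σ i j, by rw [← map_inv]; exact hDmem σ⁻¹ i j⟩
  -- Step 5: the block form of `M` over `E₂`
  let bE : absoluteGaloisGroup F → Matrix (Fin m) (Fin p) E₂ := fun σ =>
    Matrix.of fun i j => ((M σ : GL (Fin n) E₂) : Matrix (Fin n) (Fin n) E₂)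
      (e (Sum.inl i)) (e (Sum.inr j))
  have hME : ∀ σ, ((M σ : GL (Fin n) E₂) : Matrix (Fin n) (Fin n) E₂) =
      Matrix.reindex e e (Matrix.fromBlocks ((mA σ : GL (Fin m) E₂) : Matrix (Fin m) (Fin m) E₂)
        (bE σ) 0 ((mD σ : GL (Fin p) E₂) : Matrix (Fin p) (Fin p) E₂)) := by
    intro σ
    apply Matrix.map_injective (algebraMap E₂ (PadicAlgCl ℓ)).injective
    have hb : (Matrix.fromBlocks ((mA σ : GL (Fin m) E₂) : Matrix (Fin m) (Fin m) E₂)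
        (bE σ) 0 ((mD σ : GL (Fin p) E₂) : Matrix (Fin p) (Fin p) E₂)).map
          (algebraMap E₂ (PadicAlgCl ℓ)) =
        Matrix.fromBlocks
          ((A σ : GL (Fin m) (PadicAlgCl ℓ)) : Matrix (Fin m) (Fin m) (PadicAlgCl ℓ)) (B σ) 0
          ((D σ : GL (Fin p) (PadicAlgCl ℓ)) : Matrix (Fin p) (Fin p) (PadicAlgCl ℓ)) := by
      rw [Matrix.fromBlocks_map, Matrix.fromBlocks_inj]
      refine ⟨?_, ?_, ?_, ?_⟩
      · rw [← hmA, FramedRep.coe_baseChange_apply]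
      · ext i j
        rw [Matrix.map_apply, ← Matrix.fromBlocks_apply₁₂
          ((A σ : GL (Fin m) (PadicAlgCl ℓ)) : Matrix (Fin m) (Fin m) (PadicAlgCl ℓ)) (B σ) 0
          ((D σ : GL (Fin p) (PadicAlgCl ℓ)) : Matrix (Fin p) (Fin p) (PadicAlgCl ℓ)), ← hMe]
        rfl
      · exact Matrix.map_zero _ (map_zero _)
      · rw [← hmD, FramedRep.coe_baseChange_apply]
    dsimp only
    rw [hM σ, Matrix.reindex_apply, Matrix.reindex_apply, ← Matrix.submatrix_map, hb]
  -- Step 6: the blocks are admissible, hence `A` and `D` are de Rham with the models `mA`, `mD`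
  obtain ⟨hadmA, hadmD⟩ :=
    isAdmissible_blocks_of_eq_reindex_fromBlocks 𝔇.𝔅 e M mA mD bE hME hadmM
  refine ⟨⟨E₂, inferInstance, mA, ⟨1, ?_⟩, hadmA⟩, ⟨E₂, inferInstance, mD, ⟨1, ?_⟩, hadmD⟩⟩
  · rw [hmA]; exact conj_one_eq A
  · rw [hmD]; exact conj_one_eq D

end Blocks

end Summit.Langlands.Langlands.Theorems.IrreducibleOffSector

end
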